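import Summits.ValiantsHypothesis.ValiantsHypothesis.Theorems.NcAutomatonIntersection
import Summits.ValiantsHypothesis.ValiantsHypothesis.Theorems.NcIntervalProjection
import Summits.ValiantsHypothesis.ValiantsHypothesis.Theorems.NcDeterminantFace
import Literature.Computability.AlgebraicComplexity.HI16DetSkewCircuitProofs
import HarnessLib

/-!
# The Cayley determinant of order `2n` projects onto the Cayley permanent of order `n`

Workshop theorem for the node `CommutativityDial` (decomp-valiant lens 6, determinant face):
**Arvind–Srinivasan 2010 §4 Thm 10 in the kernel** — the Literature named fact `AS10_thm_10` is
DISCHARGED (`AS10_thm_10_holds (F) [Field F] : AS10_thm_10 F`, exponent `e = 8`) from the sharp form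
`as10_sharp` (every commutative ring): an nc circuit of size `s` for `ncDetPoly F (2n)` gives one of
size `≤ (4n+5)(2n+2)²·s` for `ncPerPoly F n`. Mechanism (automaton intersection,
`NcAutomatonIntersection.lean`): the `2n+2`-state automaton `pairDfa n` keeps exactly the words of
`Cdet_{2n}` with a DOUBLED permutation `π(2i+j) = 2π'(i)+j` (§2: sign `+1`, in bijection with `S_n`),
so the kept part is `Σ_{π'} w(double π')` (§3); the input substitution `x_{2a,2i} ↦ y_{a,i}`, other
letters `↦ 1` (`ArithCircuit.substIn`, nc semantics §1) maps it onto `Cperm_n`, and the determinant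
face of `NcDeterminantFace.lean` becomes unconditional (§3). HONEST FRAMING: theorem in print
(AS10 Thm 10; Arvind–Joglekar 2009 Thm 1), new in the kernel, determinant-specific; it removes the
hypothesis `hAS` from four support theorems and decides no crux; `VP ≠ VNP` untouched.
-/
noncomputable section

namespace Summit.ValiantsHypothesis.ValiantsHypothesis.Theorems.NcCayleyDeterminant

open Literature.Computability.AlgebraicComplexity
open Literature.Computability.AlgebraicComplexity.ArithCircuit
open Summit.ValiantsHypothesis.ValiantsHypothesis.Theorems
open Summit.ValiantsHypothesis.ValiantsHypothesis.Theorems.NcAutomatonIntersection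

universe u v w

section Complements

variable {R : Type u} [CommSemiring R] {σ : Type v} {Q : Type w} [DecidableEq Q] (δ : Q → σ → Q)

/-- The `(a,b)`-part of a word is `wordDfa`. [cite: ArvindJoglekar2009, Thm 1] -/
theorem dfaProj_prod_map_ι (a b : Q) (l : List σ) :
    dfaProj δ a b ((l.map (FreeAlgebra.ι R)).prod) = wordDfa δ a b l := by
  rw [dfaProj_apply, NcIntervalProjection.equiv_prod_map_ι, dfaProjMA_single, one_smul,
    FreeMonoid.toList_ofList]

variable [Fintype Q]

/-- (I2) **Partition** `Σ_b f^{a,b} = f`. [cite: ArvindJoglekar2009, Thm 1] -/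
theorem sum_dfaProj (f : FreeAlgebra R σ) : ∀ a : Q, ∑ b, dfaProj δ a b f = f := by
  induction f using FreeAlgebra.induction with
  | grade0 r =>
    intro a; rw [Fintype.sum_eq_single a fun b hb => by rw [dfaProj_algebraMap, if_neg (Ne.symm hb)],
      dfaProj_algebraMap, if_pos rfl]
  | grade1 x =>
    intro a; rw [Fintype.sum_eq_single (δ a x) fun b hb => by rw [dfaProj_ι, if_neg (Ne.symm hb)],
      dfaProj_ι, if_pos rfl]
  | mul f g hf hg =>
    intro a; simp_rw [dfaProj_mul]; rw [Finset.sum_comm]; simp_rw [← Finset.mul_sum, hg]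
    rw [← Finset.sum_mul, hf]
  | add f g hf hg => intro a; simp only [map_add, Finset.sum_add_distrib, hf, hg]

end Complements

/-! ## §1 Noncommutative semantics of input substitution (`ArithCircuit.substIn`) -/

section SubstIn

variable {R : Type u} [CommSemiring R] {σ : Type v} {τ : Type w}

/-- The free-algebra value of an input: a variable `ι j` or a constant `c · 1`. [cite: Burgisser2000, Rem. 2.2] -/
def ncInputVal : τ ⊕ R → FreeAlgebra R τ
  | .inl j => FreeAlgebra.ι R j
  | .inr c => algebraMap R (FreeAlgebra R τ) c

/-- Operands: substituted operand against substituted values. [cite: Burgisser2000, Rem. 2.2] -/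
theorem operand_ncEval_substIn (φ : σ → τ ⊕ R) (vals : List (FreeAlgebra R σ)) (u : Operand R σ) :
    (u.substIn φ).ncEval (vals.map (FreeAlgebra.lift R fun i => ncInputVal (φ i))) =
      FreeAlgebra.lift R (fun i => ncInputVal (φ i)) (u.ncEval vals) := by
  cases u with
  | var i => simp only [Operand.substIn, Operand.ncEval, FreeAlgebra.lift_ι_apply]; cases φ i <;> rfl
  | const c => simp [Operand.substIn, Operand.ncEval]
  | gate j =>
    simp only [Operand.substIn, Operand.ncEval, List.getD_eq_getElem?_getD, List.getElem?_map]
    cases vals[j]? <;> simp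

/-- Gates: `lift` commutes with weighted sums and ordered products. [cite: Burgisser2000, Rem. 2.2] -/
theorem gate_ncEval_substIn (φ : σ → τ ⊕ R) (vals : List (FreeAlgebra R σ)) (g : Gate R σ) :
    (g.substIn φ).ncEval (vals.map (FreeAlgebra.lift R fun i => ncInputVal (φ i))) =
      FreeAlgebra.lift R (fun i => ncInputVal (φ i)) (g.ncEval vals) := by
  cases g with
  | sum args =>
    simp only [Gate.substIn, Gate.ncEval, List.map_map, map_list_sum]
    exact congrArg List.sum (List.map_congr_left fun a _ => by
      simp only [Function.comp_apply, map_smul, operand_ncEval_substIn])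
  | prod args =>
    simp only [Gate.substIn, Gate.ncEval, List.map_map, map_list_prod]
    exact congrArg List.prod (List.map_congr_left fun u _ => by
      simp only [Function.comp_apply, operand_ncEval_substIn])

/-- Gate lists: the nc values of the substituted gates. [cite: Burgisser2000, Rem. 2.2] -/
theorem ncGateValues_substIn (φ : σ → τ ⊕ R) (gs : List (Gate R σ)) :
    ncGateValues (gs.map (Gate.substIn φ)) =
      (ncGateValues gs).map (FreeAlgebra.lift R fun i => ncInputVal (φ i)) := by
  induction gs using List.reverseRecOn with
  | nil => rfl
  | append_singleton gs g ih =>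
    rw [List.map_append, List.map_singleton, ncGateValues_append_singleton,
      ncGateValues_append_singleton, ih, gate_ncEval_substIn, List.map_append, List.map_singleton]

/-- **Nc semantics of input substitution** (twin of `eval_substIn`). [cite: Burgisser2000, Rem. 2.2] -/
theorem ncEval_substIn (φ : σ → τ ⊕ R) (P : ArithCircuit R σ) :
    (P.substIn φ).ncEval = FreeAlgebra.lift R (fun i => ncInputVal (φ i)) P.ncEval := by
  change (P.output.substIn φ).ncEval (ncGateValues (P.gates.map (Gate.substIn φ))) = _
  rw [ncGateValues_substIn, operand_ncEval_substIn]
  rfl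

/-- Input substitution keeps noncommutative circuit size. [cite: Burgisser2000, Rem. 2.2] -/
theorem hasNcCircuitSizeLE_substIn (φ : σ → τ ⊕ R) {f : FreeAlgebra R σ} {s : ℕ}
    (h : HasNcCircuitSizeLE f s) :
    HasNcCircuitSizeLE (FreeAlgebra.lift R (fun i => ncInputVal (φ i)) f) s := by
  obtain ⟨P, hP, rfl, hs⟩ := h
  exact ⟨P.substIn φ, hP.substIn φ, ncEval_substIn φ P, (size_substIn φ P).trans_le hs⟩

end SubstIn

/-! ## §2 The pairing automaton (`2n+2` states: idle, "even row `r` read", dead); doubling -/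

section Automaton

variable (n : ℕ)

/-- Position `2i + j` of `Fin (2n)` (block `i`, offset `j`). [cite: ArvindSrinivasan2010, §4 Thm 10] -/
def blk : Fin n × Fin 2 ≃ Fin (2 * n) := finProdFinEquiv.trans (finCongr (Nat.mul_comm n 2))

/-- `bix n i j = 2i + j`. [cite: ArvindSrinivasan2010, §4 Thm 10] -/
def bix (i : Fin n) (j : Fin 2) : Fin (2 * n) := blk n (i, j)

/-- The value of `bix`. [cite: ArvindSrinivasan2010, §4 Thm 10] -/
@[simp] theorem val_bix (i : Fin n) (j : Fin 2) : ((bix n i j : Fin (2 * n)) : ℕ) = 2 * i + j := by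
  show (j : ℕ) + 2 * (i : ℕ) = _
  omega

/-- Every position is a `bix`. [cite: ArvindSrinivasan2010, §4 Thm 10] -/
theorem bix_surjective (k : Fin (2 * n)) : ∃ i j, bix n i j = k :=
  ⟨⟨(k : ℕ) / 2, by have := k.isLt; omega⟩, ⟨(k : ℕ) % 2, by omega⟩,
    Fin.ext (by simp only [val_bix]; omega)⟩

/-- `List.ofFn` over `Fin (2n)` as `n` blocks of two. [cite: ArvindSrinivasan2010, §4 Thm 10] -/
theorem ofFn_two_mul {α : Type*} (g : Fin (2 * n) → α) :
    List.ofFn g = (List.ofFn fun i : Fin n => [g (bix n i 0), g (bix n i 1)]).flatten := by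
  rw [List.ofFn_mul' g]
  congr 1
  refine congrArg List.ofFn (funext fun i => ?_)
  rw [List.ofFn_succ, List.ofFn_succ, List.ofFn_zero]
  exact congrArg₂ (fun a b => [g a, g b]) (Fin.ext (by simp)) (Fin.ext (by simp))

/-- The pairing automaton on letters `(row, column)`: from idle (`some none`) an even row `r` is
remembered, then row `r+1` is demanded; else dead (`none`). [cite: ArvindSrinivasan2010, §4 Thm 10] -/
def pairDfa : Option (Option (Fin (2 * n))) → Fin (2 * n) × Fin (2 * n) → Option (Option (Fin (2 * n)))
  | none, _ => none
  | some none, x => if (x.1 : ℕ) % 2 = 0 then some (some x.1) else none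
  | some (some r), x => if (x.1 : ℕ) = r + 1 then some none else none

/-- Two steps from the idle state. [cite: ArvindSrinivasan2010, §4 Thm 10] -/
theorem pairDfa_pair (x y : Fin (2 * n) × Fin (2 * n)) :
    pairDfa n (pairDfa n (some none) x) y =
      if (x.1 : ℕ) % 2 = 0 ∧ (y.1 : ℕ) = x.1 + 1 then some none else none := by
  by_cases hx : (x.1 : ℕ) % 2 = 0
  · rw [show pairDfa n (some none) x = some (some x.1) by simp [pairDfa, hx]]
    by_cases hy : (y.1 : ℕ) = x.1 + 1
    · rw [if_pos ⟨hx, hy⟩]; simp [pairDfa, hy]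
    · rw [if_neg fun h => hy h.2]; simp [pairDfa, hy]
  · rw [show pairDfa n (some none) x = none by simp [pairDfa, hx], if_neg fun h => hx h.1]; rfl

/-- The dead state is absorbing. [cite: ArvindSrinivasan2010, §4 Thm 10] -/
theorem foldl_blocks_none (L : List (List (Fin (2 * n) × Fin (2 * n)))) :
    L.foldl (fun q l => l.foldl (pairDfa n) q) none = none := by
  have h1 : ∀ l : List (Fin (2 * n) × Fin (2 * n)), l.foldl (pairDfa n) none = none := fun l => by
    induction l with
    | nil => rfl
    | cons x l ih => exact ih
  induction L with
  | nil => rfl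
  | cons l L ih => simp only [List.foldl_cons, h1]; exact ih

/-- Blocks of two from idle: idle again iff every block is `(even row r, row r+1)`, else dead.
[cite: ArvindSrinivasan2010, §4 Thm 10] -/
theorem run_blocks : ∀ (m : ℕ) (xs ys : Fin m → Fin (2 * n) × Fin (2 * n)),
    (List.ofFn fun i => [xs i, ys i]).foldl (fun q l => l.foldl (pairDfa n) q) (some none) =
      if ∀ i, ((xs i).1 : ℕ) % 2 = 0 ∧ ((ys i).1 : ℕ) = (xs i).1 + 1 then some none else none
  | 0, xs, ys => by rw [List.ofFn_zero, List.foldl_nil]; exact (if_pos (by exact fun i => i.elim0)).symm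
  | m + 1, xs, ys => by
    simp only [List.ofFn_succ, List.foldl_cons, List.foldl_nil, pairDfa_pair]
    by_cases h0 : ((xs 0).1 : ℕ) % 2 = 0 ∧ ((ys 0).1 : ℕ) = (xs 0).1 + 1
    · rw [if_pos h0, run_blocks m (fun i => xs i.succ) (fun i => ys i.succ)]
      try dsimp only
      by_cases hall : ∀ i : Fin (m + 1), ((xs i).1 : ℕ) % 2 = 0 ∧ ((ys i).1 : ℕ) = (xs i).1 + 1
      · rw [if_pos hall, if_pos fun i : Fin m => hall i.succ]
      · have hall' : ¬ ∀ i : Fin m, ((xs i.succ).1 : ℕ) % 2 = 0 ∧ ((ys i.succ).1 : ℕ) = (xs i.succ).1 + 1 :=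
          fun h => hall fun i => Fin.cases h0 h i
        rw [if_neg hall, if_neg hall']
    · rw [if_neg h0, foldl_blocks_none]
      split_ifs with h
      · exact absurd (h 0) h0
      · rfl

/-- The doubled permutation `2i + j ↦ 2π'(i) + j`. [cite: ArvindSrinivasan2010, §4 Thm 10] -/
def double (π' : Equiv.Perm (Fin n)) : Equiv.Perm (Fin (2 * n)) :=
  (blk n).permCongr (Equiv.prodCongrLeft fun _ : Fin 2 => π')

/-- `double π' (2i+j) = 2π'(i)+j`. [cite: ArvindSrinivasan2010, §4 Thm 10] -/
@[simp] theorem double_bix (π' : Equiv.Perm (Fin n)) (i : Fin n) (j : Fin 2) :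
    double n π' (bix n i j) = bix n (π' i) j := by
  simp only [double, bix, Equiv.permCongr_apply, Equiv.symm_apply_apply, Equiv.prodCongrLeft_apply]

/-- Doubled permutations are even. [cite: ArvindSrinivasan2010, §4 Thm 10] -/
theorem sign_double (π' : Equiv.Perm (Fin n)) : Equiv.Perm.sign (double n π') = 1 := by
  simp only [double, Equiv.Perm.sign_permCongr, Equiv.Perm.sign_prodCongrLeft, Fin.prod_univ_two,
    Int.units_mul_self]

/-- `double` is injective. [cite: ArvindSrinivasan2010, §4 Thm 10] -/
theorem double_injective : Function.Injective (double n) := fun x y h => Equiv.ext fun i => by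
  have h1 := congrArg (fun π : Equiv.Perm (Fin (2 * n)) => ((π (bix n i 0) : Fin (2 * n)) : ℕ)) h
  simp only [double_bix, val_bix, Fin.val_zero] at h1
  exact Fin.ext (by omega)

/-- Doubled permutations are accepted. [cite: ArvindSrinivasan2010, §4 Thm 10] -/
theorem good_double (π' : Equiv.Perm (Fin n)) (i : Fin n) :
    ((double n π' (bix n i 0) : Fin (2 * n)) : ℕ) % 2 = 0 ∧
      ((double n π' (bix n i 1) : Fin (2 * n)) : ℕ) = (double n π' (bix n i 0) : ℕ) + 1 := by
  rw [double_bix, double_bix, val_bix, val_bix, Fin.val_zero, Fin.val_one]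
  exact ⟨by omega, by omega⟩

/-- An accepted permutation is doubled. [cite: ArvindSrinivasan2010, §4 Thm 10] -/
theorem exists_double (π : Equiv.Perm (Fin (2 * n)))
    (h : ∀ i : Fin n, ((π (bix n i 0) : Fin (2 * n)) : ℕ) % 2 = 0 ∧
      ((π (bix n i 1) : Fin (2 * n)) : ℕ) = (π (bix n i 0) : ℕ) + 1) :
    ∃ π' : Equiv.Perm (Fin n), double n π' = π := by
  have hrow : ∀ (i : Fin n) (j : Fin 2),
      bix n ⟨(π (bix n i 0) : ℕ) / 2, by have := (π (bix n i 0)).isLt; omega⟩ j = π (bix n i j) := by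
    intro i; rw [Fin.forall_fin_two]; obtain ⟨h0, h1⟩ := h i
    exact ⟨Fin.ext (by simp only [val_bix, Fin.val_zero]; omega),
      Fin.ext (by simp only [val_bix, Fin.val_one]; omega)⟩
  have hinj : Function.Injective fun i : Fin n =>
      (⟨(π (bix n i 0) : ℕ) / 2, by have := (π (bix n i 0)).isLt; omega⟩ : Fin n) := by
    intro i i' hii'
    have h1 : π (bix n i 0) = π (bix n i' 0) := by
      rw [← hrow i 0, ← hrow i' 0]; exact congrArg (fun a => bix n a 0) hii'
    have h2 := congrArg Fin.val (π.injective h1)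
    simp only [val_bix, Fin.val_zero] at h2
    exact Fin.ext (by omega)
  refine ⟨Equiv.ofBijective _ (Finite.injective_iff_bijective.mp hinj), Equiv.ext fun k => ?_⟩
  obtain ⟨i, j, rfl⟩ := bix_surjective n k
  rw [double_bix, Equiv.ofBijective_apply]
  exact hrow i j

/-- The accepted permutations are exactly the doubled ones. [cite: ArvindSrinivasan2010, §4 Thm 10] -/
theorem filter_good_eq_image :
    (Finset.univ.filter fun π : Equiv.Perm (Fin (2 * n)) =>
      ∀ i : Fin n, ((π (bix n i 0) : Fin (2 * n)) : ℕ) % 2 = 0 ∧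
        ((π (bix n i 1) : Fin (2 * n)) : ℕ) = (π (bix n i 0) : ℕ) + 1) =
      Finset.univ.image (double n) := by
  ext π
  simp only [Finset.mem_filter, Finset.mem_univ, true_and, Finset.mem_image]
  exact ⟨exists_double n π, by rintro ⟨π', rfl⟩; exact good_double n π'⟩

end Automaton

/-! ## §3 The kept part of the Cayley determinant; halving the letters; AS10 Thm 10 -/

section Determinant

variable (F : Type u) [CommRing F] (n : ℕ)

/-- The kept part of the word of `π`. [cite: ArvindSrinivasan2010, §4 Thm 10] -/
theorem wordDfa_det (π : Equiv.Perm (Fin (2 * n))) :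
    wordDfa (R := F) (pairDfa n) (some none) (some none) (List.ofFn fun k => (π k, k)) =
      if ∀ i : Fin n, ((π (bix n i 0) : Fin (2 * n)) : ℕ) % 2 = 0 ∧
          ((π (bix n i 1) : Fin (2 * n)) : ℕ) = (π (bix n i 0) : ℕ) + 1
      then (List.ofFn fun k => FreeAlgebra.ι F (π k, k)).prod else 0 := by
  unfold wordDfa
  rw [(ofFn_two_mul n fun k => (π k, k)), List.foldl_flatten, run_blocks,
    ← (ofFn_two_mul n fun k => (π k, k))]
  simp only [List.map_ofFn, Function.comp_def]
  by_cases hG : ∀ i : Fin n, ((π (bix n i 0) : Fin (2 * n)) : ℕ) % 2 = 0 ∧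
      ((π (bix n i 1) : Fin (2 * n)) : ℕ) = (π (bix n i 0) : ℕ) + 1
  · rw [if_pos hG, if_pos hG, if_pos rfl]
  · rw [if_neg hG, if_neg hG, if_neg (by simp)]

/-- **The kept part of `Cdet_{2n}` = the doubled words** (all of sign `+1`). [cite: ArvindSrinivasan2010, §4 Thm 10] -/
theorem dfaProj_ncDetPoly :
    dfaProj (pairDfa n) (some none) (some none) (ncDetPoly F (2 * n)) =
      ∑ π' : Equiv.Perm (Fin n),
        (List.ofFn fun k : Fin (2 * n) => FreeAlgebra.ι F (double n π' k, k)).prod := by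
  have hπ : ∀ π : Equiv.Perm (Fin (2 * n)),
      dfaProj (pairDfa n) (some none) (some none)
          (Equiv.Perm.sign π • (List.ofFn fun k : Fin (2 * n) => FreeAlgebra.ι F (π k, k)).prod) =
        if ∀ i : Fin n, ((π (bix n i 0) : Fin (2 * n)) : ℕ) % 2 = 0 ∧
            ((π (bix n i 1) : Fin (2 * n)) : ℕ) = (π (bix n i 0) : ℕ) + 1
        then (Equiv.Perm.sign π : ℤ) • (List.ofFn fun k : Fin (2 * n) => FreeAlgebra.ι F (π k, k)).prod
        else 0 := by
    intro π
    rw [Units.smul_def, map_zsmul, show (List.ofFn fun k : Fin (2 * n) => FreeAlgebra.ι F (π k, k)) =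
        (List.ofFn fun k => (π k, k)).map (FreeAlgebra.ι F) from List.map_ofFn.symm,
      dfaProj_prod_map_ι, wordDfa_det, smul_ite, zsmul_zero]
    simp only [List.map_ofFn, Function.comp_def]
  rw [ncDetPoly, map_sum]
  simp_rw [hπ]
  rw [← Finset.sum_filter, filter_good_eq_image,
    Finset.sum_image (by intro x _ y _ hxy; exact double_injective n hxy)]
  refine Finset.sum_congr rfl fun π' _ => ?_
  rw [sign_double, Units.val_one, one_zsmul]

/-- The halving input substitution. [cite: ArvindSrinivasan2010, §4 Thm 10] -/
def halve (x : Fin (2 * n) × Fin (2 * n)) : (Fin n × Fin n) ⊕ F :=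
  if (x.1 : ℕ) % 2 = 0 ∧ (x.2 : ℕ) % 2 = 0 then
    Sum.inl (⟨(x.1 : ℕ) / 2, by have := x.1.isLt; omega⟩, ⟨(x.2 : ℕ) / 2, by have := x.2.isLt; omega⟩)
  else Sum.inr 1

/-- `halve (2a, 2i) = y_{a,i}`. [cite: ArvindSrinivasan2010, §4 Thm 10] -/
theorem halve_bix₀ (a i : Fin n) : halve F n (bix n a 0, bix n i 0) = Sum.inl (a, i) := by
  unfold halve
  rw [if_pos (by simp only [val_bix, Fin.val_zero]; omega)]
  exact congrArg Sum.inl (Prod.ext (Fin.ext (by simp only [val_bix, Fin.val_zero]; omega))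
    (Fin.ext (by simp only [val_bix, Fin.val_zero]; omega)))

/-- A letter at an odd column halves to `1`. [cite: ArvindSrinivasan2010, §4 Thm 10] -/
theorem halve_bix₁ (r : Fin (2 * n)) (i : Fin n) : halve F n (r, bix n i 1) = Sum.inr 1 := by
  unfold halve
  rw [if_neg (by simp only [val_bix, Fin.val_one]; omega)]

/-- A doubled word halves to the word of `π'` in `Cperm_n`. [cite: ArvindSrinivasan2010, §4 Thm 10] -/
theorem lift_word_double (π' : Equiv.Perm (Fin n)) :
    FreeAlgebra.lift F (fun x => ncInputVal (halve F n x))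
        (List.ofFn fun k : Fin (2 * n) => FreeAlgebra.ι F (double n π' k, k)).prod =
      (List.ofFn fun i : Fin n => FreeAlgebra.ι F (π' i, i)).prod := by
  rw [map_list_prod, List.map_ofFn, ofFn_two_mul n, List.prod_flatten, List.map_ofFn]
  congr 1
  refine congrArg List.ofFn (funext fun i => ?_)
  simp only [Function.comp_apply, List.prod_cons, List.prod_nil, mul_one, FreeAlgebra.lift_ι_apply,
    double_bix, halve_bix₀, halve_bix₁, ncInputVal, map_one]

/-- **AS10 Thm 10, sharp form** (every commutative ring): size `s` for `Cdet_{2n}` ⟹ size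
`≤ (4n+5)(2n+2)²·s` for `Cperm_n`. [cite: ArvindSrinivasan2010, §4 Thm 10] -/
theorem as10_sharp (s : ℕ) (h : HasNcCircuitSizeLE (ncDetPoly F (2 * n)) s) :
    HasNcCircuitSizeLE (ncPerPoly F n) ((4 * n + 5) * (2 * n + 2) ^ 2 * s) := by
  obtain ⟨P, hP, hPval, hs⟩ := h
  have h1 := hasNcCircuitSizeLE_dfaProj (pairDfa n) P hP (some none) (some none)
  rw [hPval, dfaProj_ncDetPoly] at h1
  have h2 := hasNcCircuitSizeLE_substIn (halve F n) h1
  rw [map_sum] at h2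
  simp_rw [lift_word_double] at h2
  have hc : Fintype.card (Option (Option (Fin (2 * n)))) = 2 * n + 1 + 1 := by
    rw [Fintype.card_option, Fintype.card_option, Fintype.card_fin]
  rw [hc] at h2
  rw [ncPerPoly]
  exact h2.mono (Nat.mul_le_mul (le_of_eq (by ring)) hs)

end Determinant

/-- **THE NAMED FACT `AS10_thm_10` DISCHARGED** (exponent `e = 8`: `(4n+5)(2n+2)²s ≤ 16m⁴ ≤ m⁸`,
`m = s+n+2 ≥ 2`). [cite: ArvindSrinivasan2010, §4 Thm 10] -/
theorem AS10_thm_10_holds (F : Type u) [Field F] : AS10_thm_10 F := by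
  unfold AS10_thm_10
  refine ⟨8, fun n s h => (as10_sharp F n s h).mono ?_⟩
  have h16 : 16 ≤ (s + n + 2) ^ 4 :=
    (le_of_eq (by norm_num)).trans (Nat.pow_le_pow_left (show 2 ≤ s + n + 2 by omega) 4)
  calc (4 * n + 5) * (2 * n + 2) ^ 2 * s
      ≤ (4 * (s + n + 2)) * (2 * (s + n + 2)) ^ 2 * (s + n + 2) := by gcongr <;> omega
    _ = 16 * (s + n + 2) ^ 4 := by ring
    _ ≤ (s + n + 2) ^ 4 * (s + n + 2) ^ 4 := Nat.mul_le_mul_right _ h16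
    _ = (s + n + 2) ^ 8 := by ring

/-- (III1) **`S ⟹ NcDetHard` unconditionally.** [cite: ArvindSrinivasan2010, §4 Thm 10] -/
theorem ncDetHard_of_vh (hS : _root_.ValiantsHypothesis) : NcDeterminantFace.NcDetHard :=
  NcDeterminantFace.ncDetHard_of_vh (AS10_thm_10_holds ℂ) hS

/-- (III2) `S ⟺ NcDetHard ∧ DetLift` unconditionally. [cite: ArvindSrinivasan2010, §4 Thm 10] -/
theorem summit_iff_det_split :
    _root_.ValiantsHypothesis ↔ NcDeterminantFace.NcDetHard ∧ NcDeterminantFace.DetLift :=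
  NcDeterminantFace.summit_iff_det_split (AS10_thm_10_holds ℂ)

/-- (III3) `DetLift ⟹ NcLift` unconditionally. [cite: ArvindSrinivasan2010, §4 Thm 10] -/
theorem ncLift_of_detLift (hB : NcDeterminantFace.DetLift) : NcSemantics.NcLift :=
  NcDeterminantFace.ncLift_of_detLift (AS10_thm_10_holds ℂ) hB

/-- (III4) `A_nc ⟹ NcDetHard`, unconditionally. [cite: ArvindSrinivasan2010, §4 Thm 10] -/
theorem ncDetHard_of_perNotNcVP (hA : NcSemantics.PerNotNcVP) : NcDeterminantFace.NcDetHard :=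
  NcDeterminantFace.ncDetHard_of_perNotNcVP (AS10_thm_10_holds ℂ) hA

end Summit.ValiantsHypothesis.ValiantsHypothesis.Theorems.NcCayleyDeterminant

end
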